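import Mathlib.Analysis.SpecialFunctions.Exp
import Literature.Computability.QuantumComplexity.AaronsonAmbainis
import HarnessLib

/-!
# Filmus–Hatami–Keller–Lifshitz: the sum of `L¹` influences of a bounded low-degree function,
# and the variance of transitive-invariant bounded low-degree functions

Topic `Literature/Computability/QuantumComplexity` (beside `AaronsonAmbainis.lean`, whose cube
vocabulary `boolAvg` / `evalBool` / `flipBit` / `boolVariance` / `influence` is used verbatim).
Two NAMED FACTS (statements as printed, no proofs), vendored by a grounder for route
`QuantumAdvantage/SpikesNeedAddresses`:

* `FilmusEtAl2016_thm33` — Filmus–Hatami–Keller–Lifshitz, *On the sum of the L₁ influences of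
  bounded functions*, Israel J. Math. 214 (2016) 167–192 = arXiv:1404.3396, **Theorem 3.3**
  (PDF p. 6 of the arXiv text): for `f : {-1,1}ⁿ → [-1,1]` of degree `d`,
  `Inf⁽¹⁾[f] ≤ ‖Δ(f)‖_∞ ≤ d²`, where `Inf⁽¹⁾[f] = ∑ᵢ E |(f(x) - f(x ⊕ eᵢ))/2|` (§1, PDF p. 3).
  Grounds `Summit.QuantumAdvantage.QuantumAdvantage.Theses.SpikesNeedAddresses.FHKLTotalL1`
  (stmt-QuantumAdvantage-11703, which asks only `≤ 2d²`).
* `FilmusEtAl2016_prop318` — ibid. **Proposition 3.18** (§3.5 "Application to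
  transitive-invariant functions", PDF p. 10): every transitive-invariant `f : {-1,1}ⁿ → [-1,1]`
  of degree `d` satisfies `Inf⁽ᵖ⁾[f] ≤ d^{2p} e^{pd} / n^{p-1}` for `1 ≤ p ≤ 2`; "In particular,
  `Var[f] ≤ Inf⁽²⁾[f] ≤ d⁴ e^{2d} / n`." Only this `p = 2` clause is vendored. It is the nearest
  print to `…SpikesNeedAddresses.TransitiveVariance` (stmt-QuantumAdvantage-11700), which asks for
  `poly(d)` in place of `d⁴ e^{2d}` (open; cf. the Aaronson–Ambainis conjecture `AAConjecture`).

## Dictionary `{-1,1}ⁿ → [-1,1]` versus `{0,1}ᴺ → [0,1]`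

The tree works with real polynomials `p` in `N` variables evaluated on `{0,1}ᴺ` (`evalBool`) with
`0 ≤ p ≤ 1` there. Put `f := 2p - 1 ∘ (affine recoding of the cube)`: `f` is `[-1,1]`-valued, its
multilinear degree equals that of `p` (hence `≤ p.totalDegree`), and for every coordinate `i`
`(f(x) - f(x ⊕ eᵢ))/2 = p(X) - p(Xⁱ)`. Therefore FHKL's `Inf⁽¹⁾ᵢ[f] = E_X |p(X) - p(Xⁱ)|`,
`Inf⁽²⁾ᵢ[f] = E_X (p(X) - p(Xⁱ))² = influence i p`, and `Var[f] = 4 · boolVariance p`. The facts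
below are the printed inequalities rewritten through this dictionary (an exact translation, not a
variant); the degree hypothesis is stated as `p.totalDegree ≤ d`, which bounds the multilinear
degree of `f` (the printed bounds are monotone in `d`). Transitive invariance is FHKL's
(§3.5): for all `i, j` there is `σ ∈ Sₙ` with `σ(i) = j` and `f(x_{σ(1)}, …, x_{σ(n)}) = f(x)`
for every `x` — written on `evalBool p` exactly as in the route item. For `N = 0` both facts hold
trivially (`∑` over `Fin 0`, variance of a one-point cube, `x / 0 = 0`), consistent with print
where `n ≥ 1` is implicit.

## References

* [FilmusEtAl2016] Y. Filmus, H. Hatami, N. Keller, N. Lifshitz, Israel J. Math. 214 (2016)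
  167–192, doi:10.1007/s11856-016-1355-0, arXiv:1404.3396 — Thm. 3.3 (p. 6), Prop. 3.18 (p. 10),
  §1 definitions of `Inf⁽ᵖ⁾` (p. 3).
* [AaronsonAmbainis2014] S. Aaronson, A. Ambainis, Theory of Computing 10 (2014) 133–166 —
  the question `Inf⁽¹⁾[f] = deg^{O(1)} f · ‖f‖_∞ ?` answered by Thm. 3.3 (Bačkurs–Bavarian `O(d³)`
  first).
* [DinurEtAl2007] I. Dinur, E. Friedgut, G. Kindler, R. O'Donnell, Israel J. Math. 160 (2007) —
  the earlier transitive bound `Var[f] ≤ e^{O(d)}/√n` improved by Prop. 3.18 (tree: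
  `dfko2007_influence_bounded`, `DFKOInfluenceBound.lean`).
-/

noncomputable section

namespace Literature.Computability.QuantumComplexity

variable {N : ℕ}

/-- **Filmus–Hatami–Keller–Lifshitz 2016, Theorem 3.3** (the sum of `L¹` influences of a
bounded degree-`d` function is at most `d²`): "Let `f : {-1,1}ⁿ → [-1,1]` be a function of
degree `d`. Then `Inf[f] ≤ ‖Δ(f)‖_∞ ≤ d²`", `Inf[f] = Inf⁽¹⁾[f] = ∑ᵢ E|(f(x) - f(x ⊕ eᵢ))/2|`.
Through the dictionary `f = 2p - 1` of the module docstring (`(f - fⁱ)/2 = p - pⁱ`): for a real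
polynomial `p` of total degree `≤ d` with `0 ≤ p ≤ 1` on `{0,1}ᴺ`,
`∑ᵢ E_X |p(X) - p(Xⁱ)| ≤ d²`. Only the outer inequality `Inf[f] ≤ d²` is vendored (the middle
quantity `‖Δ(f)‖_∞` is not named in the tree). Grounds
`Summit.QuantumAdvantage.QuantumAdvantage.Theses.SpikesNeedAddresses.FHKLTotalL1`
(stmt-QuantumAdvantage-11703 asks `≤ 2d²`: item = fact ∘ `le_trans`). A named fact, not proved
here (printed proof: Sarantopoulos' Banach-space Bernstein–Markov inequality, Prop. 3.2).
[cite: FilmusEtAl2016, Thm. 3.3] -/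
def FilmusEtAl2016_thm33 : Prop :=
  ∀ (N d : ℕ) (p : MvPolynomial (Fin N) ℝ), p.totalDegree ≤ d →
    (∀ x, 0 ≤ evalBool p x ∧ evalBool p x ≤ 1) →
      ∑ i : Fin N, boolAvg (fun x => |evalBool p x - evalBool p (flipBit i x)|) ≤ (d : ℝ) ^ 2

/-- **Filmus–Hatami–Keller–Lifshitz 2016, Proposition 3.18** (variance of transitive-invariant
bounded low-degree functions), the printed "in particular" clause (`p = 2`): "Every
transitive-invariant function `f : {-1,1}ⁿ → [-1,1]` of degree `d` satisfies … In particular,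
`Var[f] ≤ Inf⁽²⁾[f] ≤ d⁴ e^{2d} / n`." Through the dictionary `f = 2p - 1`
(`Var[f] = 4 Var[p]`, `Inf⁽²⁾ᵢ[f] = influence i p`): for a real polynomial `p` of total degree
`≤ d` with `0 ≤ p ≤ 1` on `{0,1}ᴺ` that is transitive-invariant (for all `i, j` some coordinate
permutation `σ` with `σ i = j` leaves `X ↦ p(X)` invariant),
`4 · Var[p] ≤ ∑ᵢ Inf_i[p] ≤ d⁴ e^{2d} / N`. The general clause `Inf⁽ᵖ⁾[f] ≤ d^{2p}e^{pd}/n^{p-1}`,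
`1 ≤ p ≤ 2`, is not vendored. Nearest print to
`Summit.QuantumAdvantage.QuantumAdvantage.Theses.SpikesNeedAddresses.TransitiveVariance`
(stmt-QuantumAdvantage-11700), which is STRONGER (asks `C d^b / N^c`, polynomial in `d`); improves
the `e^{O(d)}/√n` consequence of Dinur–Friedgut–Kindler–O'Donnell (`dfko2007_influence_bounded`).
A named fact, not proved here (printed proof: hypercontractivity `‖fᵢ‖₂ ≤ e^{d}‖fᵢ‖₁`, equality
of the influences, and Thm. 3.3). [cite: FilmusEtAl2016, Prop. 3.18] -/
def FilmusEtAl2016_prop318 : Prop :=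
  ∀ (N d : ℕ) (p : MvPolynomial (Fin N) ℝ), p.totalDegree ≤ d →
    (∀ x, 0 ≤ evalBool p x ∧ evalBool p x ≤ 1) →
      (∀ i j : Fin N, ∃ σ : Equiv.Perm (Fin N), σ i = j ∧
        ∀ x : Fin N → Bool, evalBool p (fun k => x (σ k)) = evalBool p x) →
      4 * boolVariance p ≤ ∑ i : Fin N, influence i p ∧
        ∑ i : Fin N, influence i p ≤ (d : ℝ) ^ 4 * Real.exp (2 * d) / N

/-! ### Sanity API (trivial instances; keeps the facts honest at the degenerate sizes) -/

/-- At `N = 0` the conclusion of `FilmusEtAl2016_thm33` is `0 ≤ d²`. [folklore] -/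
theorem FilmusEtAl2016_thm33_conclusion_zero (d : ℕ) (p : MvPolynomial (Fin 0) ℝ) :
    ∑ i : Fin 0, boolAvg (fun x => |evalBool p x - evalBool p (flipBit i x)|) ≤ (d : ℝ) ^ 2 := by
  simp only [Finset.univ_eq_empty, Finset.sum_empty]
  positivity

/-- The `L¹` influences are nonnegative, so `FilmusEtAl2016_thm33` bounds each of them by `d²`.
[cite: FilmusEtAl2016, Thm. 3.3] -/
theorem FilmusEtAl2016_thm33.single (h : FilmusEtAl2016_thm33) {N d : ℕ}
    {p : MvPolynomial (Fin N) ℝ} (hp : p.totalDegree ≤ d)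
    (hb : ∀ x, 0 ≤ evalBool p x ∧ evalBool p x ≤ 1) (i : Fin N) :
    boolAvg (fun x => |evalBool p x - evalBool p (flipBit i x)|) ≤ (d : ℝ) ^ 2 := by
  refine le_trans ?_ (h N d p hp hb)
  exact Finset.single_le_sum (f := fun j => boolAvg (fun x => |evalBool p x - evalBool p (flipBit j x)|))
    (fun j _ => boolAvg_nonneg fun _ => abs_nonneg _) (Finset.mem_univ i)

/-- `FilmusEtAl2016_prop318` in variance form: a transitive-invariant bounded `p` of total degree
`≤ d` has `Var[p] ≤ d⁴ e^{2d} / (4N)`. [cite: FilmusEtAl2016, Prop. 3.18] -/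
theorem FilmusEtAl2016_prop318.boolVariance_le (h : FilmusEtAl2016_prop318) {N d : ℕ}
    {p : MvPolynomial (Fin N) ℝ} (hp : p.totalDegree ≤ d)
    (hb : ∀ x, 0 ≤ evalBool p x ∧ evalBool p x ≤ 1)
    (ht : ∀ i j : Fin N, ∃ σ : Equiv.Perm (Fin N), σ i = j ∧
      ∀ x : Fin N → Bool, evalBool p (fun k => x (σ k)) = evalBool p x) :
    boolVariance p ≤ (d : ℝ) ^ 4 * Real.exp (2 * d) / N / 4 := by
  obtain ⟨h1, h2⟩ := h N d p hp hb ht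
  linarith

end Literature.Computability.QuantumComplexity
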